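import Summits.RiemannHypothesis.RiemannHypothesis.Theorems.JensenPolynomialsDefs
import Literature.NumberTheory.LFunctions.JensenAsymptotics

/-!
# Route `JensenPolynomials`, FAR crux `XiWindowZeroFreeRelFar` (B1-rel) — the window EGF of `ξ` as a kernel integral
(RH-FREE; cell rh-jensen, HUMAN RULING D-0040; the IDENTITY layer of the steepest-descent / far-Gumbel line)

For `γ = xiTaylorCoeff` (GORZ's Taylor data of `ξ`), `Φ = deBruijnPhi`, `μ_j = xiMoment j = ∫₀^∞ Φ(u)u^j du`, the
normalised window EGF polynomial `F_M(s) = 1 + Σ_{k=1}^{M} r̃_k(M)s^k/k!` (`r̃_k = windowSeqDown γ M k`) of the crux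
`XiWindowZeroFreeRelFar` IS a kernel integral:

  `μ_{2M}·F_M(s) = ∫₀^∞ Φ(u) u^{2M} T_M(s·c_M/((M−½)u²)) du`,  `T_M(w) = Σ_{k≤M} binom(M−½,k) w^k`,  `c_M = μ_{2M}/μ_{2M−2}`

(`integralRepr`), from the moment dictionary `γ(n) = 64·4ⁿ n!/(2n)!·μ_{2n}` (`xiTaylorCoeff_eq_xiMoment`) in its one-step
form `γ(m+1)(m+½)μ_{2m} = γ(m)μ_{2m+2}` (`GORZAsymp.xiTaylorCoeff_succ_mul`): `γ(M−k)·μ_{2M} = (M−½)_k↓·γ(M)·μ_{2M−2k}`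
(`xiTaylorCoeff_sub_mul_xiMoment`), whence `r̃_k(M)·μ_{2M} = (M−½)_k↓ (c_M/(M−½))^k μ_{2M−2k}`
(`windowSeqDown_mul_xiMoment`); then a finite sum ↔ integral interchange. The analytic debt of the crux (zero-freeness on
`‖s‖ ≤ (7/20)M` and the relative log bound against `e^{P₃(s)}`) is thereby posed on ONE Laplace-type integral whose large
parameter `M` sits in the exponent `u^{2M}` — the input of every contour line for item `stmt-RiemannHypothesis-19465`
(theory g7's line «steepest-descent», theory g8's line «far-gumbel»). This file is theory g7's HOME-proved
`rh-jensen-theory/g7/lines/IntegralRepr.lean` (2026-08-26), moved under `Theorems` verbatim up to the namespace; valid for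
every `M ≥ 1` and every `s ∈ ℂ` (no pin). WHAT THIS IS NOT: an identity between explicit real numbers attached to `ξ`'s
Taylor coefficients and the positive kernel `Φ`; nothing here bears on the zeros of `ζ` or the truth of RH.
References: GORZ 2019 eq. (1) [GORZPNAS2019]; Griffin–Ono–Rolen–Thorner–Tripp–Wagner 2022 §2 [GriffinEtAl2022].
-/

noncomputable section
-- D-0017: `Summit.RiemannHypothesis.RiemannHypothesis.…` duplicates the namespace BY DESIGN (single-problem summit).
set_option linter.dupNamespace false

namespace Summit.RiemannHypothesis.RiemannHypothesis.Theorems.JensenPolynomials.WindowEGF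

open Literature.NumberTheory.LFunctions MeasureTheory Finset
/-- Dictionary, additive form: `γ(m)·μ_{2(m+k)} = (m+k−½)_k↓ · γ(m+k) · μ_{2m}`. -/
theorem xiTaylorCoeff_mul_xiMoment_add (k : ℕ) : ∀ m : ℕ,
    xiTaylorCoeff m * xiMoment (2 * (m + k)) =
      (descPochhammer ℝ k).eval (((m + k : ℕ) : ℝ) - 1 / 2) * xiTaylorCoeff (m + k) * xiMoment (2 * m) := by
  induction k with
  | zero => intro m; simp
  | succ k ih =>
    intro m
    have hIH := ih (m + 1)
    have h1 := GORZAsymp.xiTaylorCoeff_succ_mul m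
    have e1 : m + (k + 1) = m + 1 + k := by ring
    have e2 : 2 * (m + 1) = 2 * m + 2 := by ring
    rw [e2] at hIH
    rw [e1, descPochhammer_succ_eval]
    have hμ : xiMoment (2 * m + 2) ≠ 0 := (xiMoment_pos _).ne'
    apply mul_right_cancel₀ hμ
    calc xiTaylorCoeff m * xiMoment (2 * (m + 1 + k)) * xiMoment (2 * m + 2)
        = (xiTaylorCoeff m * xiMoment (2 * m + 2)) * xiMoment (2 * (m + 1 + k)) := by ring
      _ = (xiTaylorCoeff (m + 1) * (((m : ℝ) + 1 / 2) * xiMoment (2 * m))) * xiMoment (2 * (m + 1 + k)) := by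
          rw [h1]
      _ = ((m : ℝ) + 1 / 2) * xiMoment (2 * m) * (xiTaylorCoeff (m + 1) * xiMoment (2 * (m + 1 + k))) := by ring
      _ = ((m : ℝ) + 1 / 2) * xiMoment (2 * m) *
            ((descPochhammer ℝ k).eval (((m + 1 + k : ℕ) : ℝ) - 1 / 2) * xiTaylorCoeff (m + 1 + k) *
              xiMoment (2 * m + 2)) := by rw [hIH]
      _ = _ := by push_cast; ring

/-- Dictionary, window form: `γ(M−k)·μ_{2M} = (M−½)_k↓ · γ(M) · μ_{2M−2k}` for `k ≤ M`. -/
theorem xiTaylorCoeff_sub_mul_xiMoment {M k : ℕ} (hk : k ≤ M) :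
    xiTaylorCoeff (M - k) * xiMoment (2 * M) =
      (descPochhammer ℝ k).eval ((M : ℝ) - 1 / 2) * xiTaylorCoeff M * xiMoment (2 * M - 2 * k) := by
  obtain ⟨m, rfl⟩ : ∃ m, M = m + k := ⟨M - k, by omega⟩
  have h := xiTaylorCoeff_mul_xiMoment_add k m
  rw [Nat.add_sub_cancel, show 2 * (m + k) - 2 * k = 2 * m by omega]
  exact h

/-- The downward window ratios through moments: `r̃_k(M)·μ_{2M} = (M−½)_k↓ · (c_M/(M−½))^k · μ_{2M−2k}`,
`c_M = μ_{2M}/μ_{2M−2}`, for `1 ≤ k ≤ M`. -/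
theorem windowSeqDown_mul_xiMoment {M k : ℕ} (hM : 1 ≤ M) (hk1 : 1 ≤ k) (hk : k ≤ M) :
    windowSeqDown xiTaylorCoeff M k * xiMoment (2 * M) =
      (descPochhammer ℝ k).eval ((M : ℝ) - 1 / 2) *
        (xiMoment (2 * M) / xiMoment (2 * M - 2) / ((M : ℝ) - 1 / 2)) ^ k * xiMoment (2 * M - 2 * k) := by
  have hA := xiTaylorCoeff_sub_mul_xiMoment hk
  have hGm : xiTaylorCoeff (M - 1) * xiMoment (2 * M) =
      xiTaylorCoeff M * (((M : ℝ) - 1 / 2) * xiMoment (2 * M - 2)) := by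
    obtain ⟨m, rfl⟩ : ∃ m, M = m + 1 := ⟨M - 1, by omega⟩
    have h1 := GORZAsymp.xiTaylorCoeff_succ_mul m
    rw [Nat.add_sub_cancel, show 2 * (m + 1) = 2 * m + 2 by ring, show 2 * m + 2 - 2 = 2 * m by omega]
    push_cast
    rw [show (m : ℝ) + 1 - 1 / 2 = (m : ℝ) + 1 / 2 by ring]
    linarith [h1]
  have hGm0 : xiTaylorCoeff (M - 1) ≠ 0 := (xiTaylorCoeff_pos_holds _).ne'
  have hμ2 : xiMoment (2 * M - 2) ≠ 0 := (xiMoment_pos _).ne'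
  have hM' : (M : ℝ) - 1 / 2 ≠ 0 := by
    have : (1 : ℝ) ≤ M := by exact_mod_cast hM
    intro h; linarith
  have hratio : xiTaylorCoeff M / xiTaylorCoeff (M - 1) =
      xiMoment (2 * M) / xiMoment (2 * M - 2) / ((M : ℝ) - 1 / 2) := by
    rw [div_div, div_eq_div_iff hGm0 (mul_ne_zero hμ2 hM')]
    linear_combination (-1 : ℝ) * hGm
  obtain ⟨j, rfl⟩ : ∃ j, k = j + 1 := ⟨k - 1, by omega⟩
  rw [windowSeqDown, Nat.add_sub_cancel, ← hratio]
  calc xiTaylorCoeff (M - (j + 1)) * xiTaylorCoeff M ^ j / xiTaylorCoeff (M - 1) ^ (j + 1) * xiMoment (2 * M)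
      = (xiTaylorCoeff (M - (j + 1)) * xiMoment (2 * M)) * xiTaylorCoeff M ^ j /
          xiTaylorCoeff (M - 1) ^ (j + 1) := by ring
    _ = ((descPochhammer ℝ (j + 1)).eval ((M : ℝ) - 1 / 2) * xiTaylorCoeff M * xiMoment (2 * M - 2 * (j + 1))) *
          xiTaylorCoeff M ^ j / xiTaylorCoeff (M - 1) ^ (j + 1) := by rw [hA]
    _ = _ := by rw [div_pow]; ring

/-- **The kernel-integral representation of the window EGF of `ξ`** (theory g7's `stub_integralRepr` of the
steepest-descent skeleton, verbatim; every `M ≥ 1`, every `s ∈ ℂ`): `μ_{2M}·(1 + Σ_{k=1}^{M} r̃_k s^k/k!) = ∫₀^∞ Φ(u)u^{2M} Σ_{k≤M} ((M−½)_k↓/k!)(s c_M/((M−½)u²))^k du`. -/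
theorem integralRepr : ∀ M : ℕ, 1 ≤ M → ∀ s : ℂ,
      (1 + ∑ k ∈ Finset.Icc 1 M, (((windowSeqDown xiTaylorCoeff M k / (Nat.factorial k : ℝ) : ℝ)) : ℂ) * s ^ k) *
          ((xiMoment (2 * M) : ℝ) : ℂ) =
        (∫ u in Set.Ioi (0 : ℝ), ((deBruijnPhi u * u ^ (2 * M) : ℝ) : ℂ) *
          ∑ k ∈ Finset.range (M + 1),
            ((((descPochhammer ℝ k).eval ((M : ℝ) - 1 / 2) / (Nat.factorial k : ℝ) : ℝ)) : ℂ) *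
              (s * (((xiMoment (2 * M) / xiMoment (2 * M - 2) : ℝ)) : ℂ) /
                (((((M : ℝ) - 1 / 2 : ℝ)) : ℂ) * (u : ℂ) ^ 2)) ^ k) := by
  intro M hM s
  -- abbreviations (the goal is rewritten in terms of `c` and `M'`)
  set c : ℝ := xiMoment (2 * M) / xiMoment (2 * M - 2) with hc
  set M' : ℝ := (M : ℝ) - 1 / 2 with hM'def
  have hM' : M' ≠ 0 := by
    have : (1 : ℝ) ≤ M := by exact_mod_cast hM
    rw [hM'def]; intro h; linarith
  have hM'c : (M' : ℂ) ≠ 0 := by exact_mod_cast hM'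
  -- the coefficient of the k-th term
  set A : ℕ → ℂ := fun k ↦
    ((((descPochhammer ℝ k).eval M' / (Nat.factorial k : ℝ) : ℝ)) : ℂ) * (s * (c : ℂ) / (M' : ℂ)) ^ k with hA
  -- Step 1: pointwise form of the integrand on (0, ∞)
  have hpt : Set.EqOn
      (fun u : ℝ ↦ ((deBruijnPhi u * u ^ (2 * M) : ℝ) : ℂ) *
          ∑ k ∈ Finset.range (M + 1),
            ((((descPochhammer ℝ k).eval M' / (Nat.factorial k : ℝ) : ℝ)) : ℂ) *
              (s * (c : ℂ) / ((M' : ℂ) * (u : ℂ) ^ 2)) ^ k)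
      (fun u : ℝ ↦ ∑ k ∈ Finset.range (M + 1), A k * ((deBruijnPhi u * u ^ (2 * M - 2 * k) : ℝ) : ℂ))
      (Set.Ioi (0 : ℝ)) := by
    intro u hu
    have hu0 : (u : ℂ) ≠ 0 := by exact_mod_cast (ne_of_gt hu)
    simp only [hA]
    rw [Finset.mul_sum]
    refine Finset.sum_congr rfl fun k hk ↦ ?_
    have hkM : k ≤ M := Nat.lt_succ_iff.mp (Finset.mem_range.mp hk)
    have hX : ((u : ℂ) ^ 2) ^ k ≠ 0 := pow_ne_zero _ (pow_ne_zero _ hu0)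
    have hsplit : (u : ℂ) ^ (2 * M) = (u : ℂ) ^ (2 * M - 2 * k) * ((u : ℂ) ^ 2) ^ k := by
      rw [← pow_mul, ← pow_add]; congr 1; omega
    have hT : (s * (c : ℂ) / ((M' : ℂ) * (u : ℂ) ^ 2)) ^ k =
        (s * (c : ℂ) / (M' : ℂ)) ^ k / ((u : ℂ) ^ 2) ^ k := by
      rw [← div_pow, div_div]
    rw [hT]
    push_cast
    rw [hsplit]
    generalize ((u : ℂ) ^ 2) ^ k = X at hX ⊢
    field_simp
  rw [setIntegral_congr_fun measurableSet_Ioi hpt]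
  -- Step 2: integrate term by term
  have hint : ∀ k ∈ Finset.range (M + 1),
      Integrable (fun u : ℝ ↦ A k * ((deBruijnPhi u * u ^ (2 * M - 2 * k) : ℝ) : ℂ))
        (volume.restrict (Set.Ioi (0 : ℝ))) := by
    intro k _
    exact ((integrableOn_deBruijnPhi_mul_pow (2 * M - 2 * k)).ofReal).const_mul (A k)
  rw [integral_finsetSum _ hint]
  have hterm : ∀ k ∈ Finset.range (M + 1),
      (∫ u in Set.Ioi (0 : ℝ), A k * ((deBruijnPhi u * u ^ (2 * M - 2 * k) : ℝ) : ℂ)) =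
        A k * ((xiMoment (2 * M - 2 * k) : ℝ) : ℂ) := by
    intro k _
    rw [integral_const_mul, integral_complex_ofReal]
    rfl
  rw [Finset.sum_congr rfl hterm]
  -- Step 3: the left side, term by term
  rw [Finset.range_eq_Ico, Finset.sum_eq_sum_Ico_succ_bot (show 0 < M + 1 by omega), zero_add,
    Finset.Ico_add_one_right_eq_Icc, add_mul, Finset.sum_mul]
  congr 1
  · simp [hA]
  · refine Finset.sum_congr rfl fun k hk ↦ ?_
    have hk1 : 1 ≤ k := (Finset.mem_Icc.mp hk).1
    have hkM : k ≤ M := (Finset.mem_Icc.mp hk).2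
    have hB := windowSeqDown_mul_xiMoment hM hk1 hkM
    have hB' : windowSeqDown xiTaylorCoeff M k / (Nat.factorial k : ℝ) * xiMoment (2 * M) =
        (descPochhammer ℝ k).eval M' / (Nat.factorial k : ℝ) * (c / M') ^ k *
          xiMoment (2 * M - 2 * k) := by
      rw [hM'def, hc, div_mul_eq_mul_div, hB]; ring
    simp only [hA]
    calc (((windowSeqDown xiTaylorCoeff M k / (Nat.factorial k : ℝ) : ℝ)) : ℂ) * s ^ k *
          ((xiMoment (2 * M) : ℝ) : ℂ)
        = (((windowSeqDown xiTaylorCoeff M k / (Nat.factorial k : ℝ) * xiMoment (2 * M) : ℝ)) : ℂ) *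
            s ^ k := by
          push_cast; ring
      _ = ((((descPochhammer ℝ k).eval M' / (Nat.factorial k : ℝ) * (c / M') ^ k *
            xiMoment (2 * M - 2 * k) : ℝ)) : ℂ) * s ^ k := by rw [hB']
      _ = _ := by push_cast; ring

end Summit.RiemannHypothesis.RiemannHypothesis.Theorems.JensenPolynomials.WindowEGF

end

-- re-landed byte-identically 2026-08-26 (eng-4 g3) to re-enqueue the olean build (director-rh g5 13:16:47Z); no content change
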